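import Summits.Ventures.LatticeQCDFlow.Scaling.BooleanStarColdStartLaw
import Summits.Ventures.LatticeQCDFlow.Scaling.TightSectorKLogKLaw

/-!
HONEST FRAMING: exact (Metropolis-corrected) sampling algorithms for lattice gauge theory; figures
of merit are autocorrelation/cost numbers at stated couplings and volumes; no continuum-physics
claim.

# BooleanWitnessColdStartLaw — ITEM 1 SETTLED ON THE WITNESS, BOTH SIDES: ON `K` COLD REPLICAS `(θ,1−θ)` WITH HOT LAW `(pθ,1−pθ)`
# EVERY UNEQUAL-CONTENT SWAP IS ACCEPTED WITH PROBABILITY `≥ p(1−θ)/(1−pθ)`, SO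
# `m/(t·ĉ·p)·log((K+1)(1−ε−Kθ)) ≤ t_mix(ε) ≤ ⌈((2t+h)/(th))·max{(1−pθ)m/(p(1−θ)c), K+1}·log((1 + K(2t+h)/(2t))/ε)⌉` —
# `Θ((K/p)·log K)` FROM BOTH SIDES, UNIFORMLY IN `θ` (lean-2 GEN-30, ours)

Venture-side (OURS).  Cell `lqcd-flow` (pub-lqcd), unit `pub-lqcd-lean-2-g30`, 2026-08-28.  Chapter P (OPEN-MATH-chapterM item 1 on
the two-point family), file 5.  The witness of `Scaling/TightSectorWitness` (O4): `S = Bool`, `μ_k = (θ,1−θ)` (`k ≥ 1`), `μ_0 = (pθ,1−pθ)`, identity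
maps, exact hot redraws, idle cold replicas; one-sided domination holds with constant exactly `p` and the sector `{⊤}` is tight with `p' = p`.
Chapter O computed every floor on it (O8: the swap budget's `log K` with the quality; O10: the half-swap card); this file discharges the
ceiling of `Scaling/BooleanStarColdStartLaw` on it.

## What is proved

* §9 **`boolWitness_accept_ge`** — for `z_0 ≠ z_l`, `min{1, π̃(y_r z)/π̃(z)} ≥ p(1−θ)/(1−pθ)`: a `⊤` at the hub always enters a cold level,
  a `⊤` at a cold level enters the hub with probability `p(1−θ)/(1−pθ) ∈ [p(1−θ), p]`;
  **`boolWitness_worstTvDist_le`** — **`d(n) ≤ (1 + K(2t+h)/(2t))·(1 − (th/(2t+h))·min{p(1−θ)c/((1−pθ)m), 1/(K+1)})ⁿ`** for every `K`,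
  hub list, `0 < t < 1`, `w_0 > 0`, `0 < p ≤ 1`, `0 < θ < 1`;
  **`boolWitness_mixingTime_two_sided`** — with O8 (`Scaling/TightSectorKLogKLaw`, in the tree):
  **`m/(t·ĉ·p)·log((K+1)(1−ε−Kθ)) ≤ t_mix(ε) ≤ ⌈ρ⁻¹·log((1 + K(2t+h)/(2t))/ε)⌉`**, `ρ = (th/(2t+h))·min{p(1−θ)c/((1−pθ)m), 1/(K+1)}`
  (`K ≥ 1`, listing between `c ≥ 1` and `ĉ`, `0 < ε`, `ε + Kθ < 1`).

Reading (no numerics implied): at uniform listing `m = cK` the two sides are `(K/(tp))·log((K+1)(1−ε−Kθ))` and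
`≈ ((2t+h)/(th))·(K(1−pθ)/(p(1−θ)))·log(K/ε)`: the persistent hub's cold-start law on the witness is `Θ((K/p)(1/t + 1/h) log K)` — linear
in `1/p`, `K log K`, and free of `log(1/θ)` although `log(1/π̃_min) ≥ K log(1/θ)`; the `L²` route (N4) pays `K log(1/θ)`, the
hypercontractive route (N14) pays `log(1/θ)`.  OPEN-MATH item 1 is thereby settled on exactly the family where the floors were computed;
the general-`S` persistent hub remains open.  NOT CLAIMED: that lattice trivializing maps behave like the witness; general `S`; anything
measured.  Literature grade (cell rule): OWN (O4 ∕ O8 ∕ P4 assembled); nothing cited as a fact; no new bib keys.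
-/

noncomputable section

open Finset Function
open Literature.Probability.MarkovChains

namespace Summit.Ventures.LatticeQCDFlow.Scaling

variable {K m : ℕ} {μ : Fin (K + 1) → Bool → ℝ} {M : Fin (K + 1) → Bool → Bool → ℝ} {w : Fin (K + 1) → ℝ} {t : ℝ}

section Witness
variable (κ : Fin m → Fin K) {p θ : ℝ}

/-! ## §9 The O4 witness: the acceptance floor `p(1−θ)/(1−pθ)` and the two-sided cold-start law -/

/-- **ON THE WITNESS EVERY SWAP BETWEEN UNEQUAL CONTENTS IS ACCEPTED WITH PROBABILITY `≥ p(1−θ)/(1−pθ)`** (`0 < p ≤ 1`, `0 < θ < 1`):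
a `⊤` at the hub always enters a cold level (`(1−pθ)θ ≥ pθ(1−θ)`), a `⊤` at a cold level enters the hub with probability exactly
`pθ(1−θ)/((1−pθ)θ) = p(1−θ)/(1−pθ) ≥ p(1−θ)`. [ours] -/
theorem boolWitness_accept_ge (hp0 : 0 < p) (hp1 : p ≤ 1) (hθ0 : 0 < θ) (hθ1 : θ < 1) (r : Fin m) (z : Fin (K + 1) → Bool)
    (hz : z 0 ≠ z (κ r).succ) :
    p * (1 - θ) / (1 - p * θ) ≤ min 1 (tensorFun (fun (k : Fin (K + 1)) (b : Bool) =>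
          if k = 0 then (if b then p * θ else 1 - p * θ) else (if b then θ else 1 - θ))
          (edgeFlowSwap (Equiv.refl Bool) 0 (κ r).succ z)
        / tensorFun (fun (k : Fin (K + 1)) (b : Bool) =>
          if k = 0 then (if b then p * θ else 1 - p * θ) else (if b then θ else 1 - θ)) z) := by
  have hpθ1 : p * θ < 1 := by nlinarith
  have hμ : ∀ (k : Fin (K + 1)) (b : Bool), 0 < (fun (k : Fin (K + 1)) (b : Bool) =>
      if k = 0 then (if b then p * θ else 1 - p * θ) else (if b then θ else 1 - θ)) k b := by
    intro k b
    by_cases hk : k = 0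
    · simp only [hk, if_true]; split_ifs; exacts [mul_pos hp0 hθ0, by linarith]
    · simp only [hk, if_false]; split_ifs; exacts [hθ0, by linarith]
  have h := accept_mul_pair κ (fun _ : Fin m => Equiv.refl Bool) hμ (α := fun r z =>
    min 1 (tensorFun (fun (k : Fin (K + 1)) (b : Bool) =>
          if k = 0 then (if b then p * θ else 1 - p * θ) else (if b then θ else 1 - θ))
          (edgeFlowSwap (Equiv.refl Bool) 0 (κ r).succ z)
        / tensorFun (fun (k : Fin (K + 1)) (b : Bool) =>
          if k = 0 then (if b then p * θ else 1 - p * θ) else (if b then θ else 1 - θ)) z)) (fun _ _ => rfl) r z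
  simp only [Equiv.refl_symm, Equiv.refl_apply, if_true, Fin.succ_ne_zero, if_false] at h
  set A := min 1 (tensorFun (fun (k : Fin (K + 1)) (b : Bool) =>
          if k = 0 then (if b then p * θ else 1 - p * θ) else (if b then θ else 1 - θ))
          (edgeFlowSwap (Equiv.refl Bool) 0 (κ r).succ z)
        / tensorFun (fun (k : Fin (K + 1)) (b : Bool) =>
          if k = 0 then (if b then p * θ else 1 - p * θ) else (if b then θ else 1 - θ)) z) with hA
  -- the two unequal-content cases
  cases h0 : z 0 <;> cases hl : z (κ r).succ <;> rw [h0, hl] at hz h <;> simp only [Bool.false_eq_true, Bool.true_eq_false,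
    if_true, if_false, ne_eq, not_true_eq_false, not_false_eq_true] at hz h
  · -- `z_0 = ⊥`, `z_l = ⊤`: acceptance `pθ(1−θ)/((1−pθ)θ)`
    have hmin : min ((1 - p * θ) * θ) (p * θ * (1 - θ)) = p * θ * (1 - θ) := min_eq_right (by nlinarith)
    rw [hmin] at h
    have hpos : 0 < (1 - p * θ) * θ := mul_pos (by linarith) hθ0
    rw [div_le_iff₀ (by linarith : (0 : ℝ) < 1 - p * θ)]
    have : A = p * θ * (1 - θ) / ((1 - p * θ) * θ) := by rw [eq_div_iff hpos.ne']; exact h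
    rw [this, div_mul_eq_mul_div, le_div_iff₀ hpos]
    nlinarith
  · -- `z_0 = ⊤`, `z_l = ⊥`: acceptance `1`
    have hmin : min (p * θ * (1 - θ)) ((1 - p * θ) * θ) = p * θ * (1 - θ) := min_eq_left (by nlinarith)
    rw [hmin] at h
    have hpos : 0 < p * θ * (1 - θ) := mul_pos (mul_pos hp0 hθ0) (by linarith)
    have : A = 1 := by
      have h' : A * (p * θ * (1 - θ)) = 1 * (p * θ * (1 - θ)) := by rw [one_mul]; exact h
      exact mul_right_cancel₀ hpos.ne' h'
    rw [this, div_le_one (by linarith)]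
    nlinarith

/-- **THE COLD-START LAW ON THE WITNESS (item 1's conjecture holds on the family of chapter O's floors):** `K` cold two-point replicas
`(θ,1−θ)`, hot law `(pθ,1−pθ)`, identity maps, exact hot redraws, idle cold replicas, any hub list with multiplicities `≥ c`,
`0 < t < 1`, `w_0 > 0`, `h = (1−t)w_0`:
**`d(n) ≤ (1 + K(2t+h)/(2t))·(1 − (th/(2t+h))·min{p(1−θ)c/((1−pθ)m), 1/(K+1)})ⁿ`** — uniformly in `θ`: no `log(1/θ)`, although
`log(1/π̃_min) = log(1/(pθ)) + K·log(1/θ)`. [ours] -/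
theorem boolWitness_worstTvDist_le (hm : 1 ≤ m) (ht0 : 0 < t) (ht1 : t < 1) (hw0 : ∀ k, 0 ≤ w k) (hw00 : 0 < w 0)
    (hw1 : ∑ k, w k = 1) (hp0 : 0 < p) (hp1 : p ≤ 1) (hθ0 : 0 < θ) (hθ1 : θ < 1)
    {c : ℕ} (hc : ∀ p' : Fin K, c ≤ (univ.filter (fun r : Fin m => κ r = p')).card) (n : ℕ) :
    worstTvDist (fun y z : Fin (K + 1) → Bool =>
        t * ptGraphSwap (fun (k : Fin (K + 1)) (b : Bool) =>
              if k = 0 then (if b then p * θ else 1 - p * θ) else (if b then θ else 1 - θ))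
            (fun r : Fin m => (((0 : Fin (K + 1)), (κ r).succ) : Fin (K + 1) × Fin (K + 1)))
            (fun _ : Fin m => Equiv.refl Bool) y z
          + (1 - t) * prodKernel w (fun (k : Fin (K + 1)) (u v : Bool) =>
              if k = 0 then (if v then p * θ else 1 - p * θ) else (if u = v then (1 : ℝ) else 0)) y z)
        (tensorFun (fun (k : Fin (K + 1)) (b : Bool) =>
          if k = 0 then (if b then p * θ else 1 - p * θ) else (if b then θ else 1 - θ))) n
      ≤ (1 + K * (2 * t + (1 - t) * w 0) / (2 * t))
        * (1 - t * ((1 - t) * w 0) / (2 * t + (1 - t) * w 0)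
            * min (p * (1 - θ) / (1 - p * θ) * c / m) (1 / (K + 1))) ^ n := by
  have hpθ1 : p * θ < 1 := by nlinarith
  have hμ : ∀ (k : Fin (K + 1)) (x : Bool), 0 < (fun (k : Fin (K + 1)) (b : Bool) =>
      if k = 0 then (if b then p * θ else 1 - p * θ) else (if b then θ else 1 - θ)) k x := by
    intro k x
    by_cases hk : k = 0
    · simp only [hk, if_true]; split_ifs; exacts [mul_pos hp0 hθ0, by linarith]
    · simp only [hk, if_false]; split_ifs; exacts [hθ0, by linarith]
  have hμ1 : ∀ k : Fin (K + 1), ∑ u, (fun (k : Fin (K + 1)) (b : Bool) =>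
      if k = 0 then (if b then p * θ else 1 - p * θ) else (if b then θ else 1 - θ)) k u = 1 := by
    intro k
    by_cases hk : k = 0
    · simp only [hk, if_true]; exact sum_bool_law _
    · simp only [hk, if_false]; exact sum_bool_law _
  have hM := fun k : Fin (K + 1) => boolWitness_rowStochastic (K := K) hp0.le hp1 hθ0.le hθ1.le k
  have hMrev := fun k : Fin (K + 1) => boolWitness_detailedBalance (K := K) (p := p) (θ := θ) k
  have hM0 : ∀ u v : Bool, (fun (k : Fin (K + 1)) (u v : Bool) =>
      if k = 0 then (if v then p * θ else 1 - p * θ) else (if u = v then (1 : ℝ) else 0)) 0 u v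
      = (fun (k : Fin (K + 1)) (b : Bool) => if k = 0 then (if b then p * θ else 1 - p * θ) else (if b then θ else 1 - θ)) 0 v := by
    intro u v; simp only [if_true]
  have ha0 : 0 ≤ p * (1 - θ) / (1 - p * θ) := div_nonneg (mul_nonneg hp0.le (by linarith)) (by linarith)
  exact boolStar_worstTvDist_le_tuned κ hm ht0 ht1 hw0 hw00 hw1 hμ hμ1 hM hMrev hM0 ha0 hc
    (boolWitness_accept_ge κ hp0 hp1 hθ0 hθ1) n

/-- **THE MIXING TIME OF THE WITNESS, BOTH SIDES (chapter O's floor O8 and this ceiling):** from the planted all-`⊤` start the swap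
budget's coupon collector gives `m/(t·ĉ·p)·log((K+1)(1−ε−Kθ)) ≤ t_mix(ε)`, and the synchronous coupling gives
`t_mix(ε) ≤ ⌈ρ⁻¹·log((1 + K(2t+h)/(2t))/ε)⌉`, `ρ = (th/(2t+h))·min{p(1−θ)c/((1−pθ)m), 1/(K+1)}` — at uniform listing `m = cK`
both sides are `Θ((K/p)·(1/t + 1/h)·log K)` up to the constants: THE COLD-START LAW OF THE MAP-ASSISTED HUB IS `K log K/p`, WITH NO
VOLUME, ON THE WITNESS (`K ≥ 1`, `0 < ε`, `ε + Kθ < 1`). [ours] -/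
theorem boolWitness_mixingTime_two_sided (hK : 1 ≤ K) (hm : 1 ≤ m) (ht0 : 0 < t) (ht1 : t < 1) (hw0 : ∀ k, 0 ≤ w k)
    (hw00 : 0 < w 0) (hw1 : ∑ k, w k = 1) (hp0 : 0 < p) (hp1 : p ≤ 1) (hθ0 : 0 < θ) (hθ1 : θ < 1)
    {c : ℕ} (hc1 : 1 ≤ c) (hc : ∀ p' : Fin K, c ≤ (univ.filter (fun r : Fin m => κ r = p')).card)
    {cmax : ℕ} (hcmax : ∀ k : Fin K, (univ.filter (fun r : Fin m => κ r = k)).card ≤ cmax)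
    {ε : ℝ} (hε0 : 0 < ε) (hε : ε + K * θ < 1) :
    m / (t * cmax * p) * Real.log (((K : ℝ) + 1) * (1 - ε - K * θ))
      ≤ (mixingTime (fun a b : Fin (K + 1) → Bool =>
              t * ptGraphSwap (fun (k : Fin (K + 1)) (b : Bool) =>
                    if k = 0 then (if b then p * θ else 1 - p * θ) else (if b then θ else 1 - θ))
                  (fun r : Fin m => (((0 : Fin (K + 1)), (κ r).succ) : Fin (K + 1) × Fin (K + 1)))
                  (fun _ : Fin m => Equiv.refl Bool) a b
                + (1 - t) * prodKernel w (fun (k : Fin (K + 1)) (u v : Bool) =>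
                    if k = 0 then (if v then p * θ else 1 - p * θ) else (if u = v then (1 : ℝ) else 0)) a b)
            (tensorFun (fun (k : Fin (K + 1)) (b : Bool) =>
              if k = 0 then (if b then p * θ else 1 - p * θ) else (if b then θ else 1 - θ))) ε : ℝ)
    ∧ mixingTime (fun a b : Fin (K + 1) → Bool =>
              t * ptGraphSwap (fun (k : Fin (K + 1)) (b : Bool) =>
                    if k = 0 then (if b then p * θ else 1 - p * θ) else (if b then θ else 1 - θ))
                  (fun r : Fin m => (((0 : Fin (K + 1)), (κ r).succ) : Fin (K + 1) × Fin (K + 1)))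
                  (fun _ : Fin m => Equiv.refl Bool) a b
                + (1 - t) * prodKernel w (fun (k : Fin (K + 1)) (u v : Bool) =>
                    if k = 0 then (if v then p * θ else 1 - p * θ) else (if u = v then (1 : ℝ) else 0)) a b)
            (tensorFun (fun (k : Fin (K + 1)) (b : Bool) =>
              if k = 0 then (if b then p * θ else 1 - p * θ) else (if b then θ else 1 - θ))) ε
      ≤ ⌈1 / (t * ((1 - t) * w 0) / (2 * t + (1 - t) * w 0)
              * min (p * (1 - θ) / (1 - p * θ) * c / m) (1 / (K + 1)))
          * Real.log ((1 + K * (2 * t + (1 - t) * w 0) / (2 * t)) / ε)⌉₊ := by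
  refine ⟨boolWitness_mixingTime_ge_klogk κ hK hm ht0 ht1 hw0 hw00 hw1 hp0 hp1 hθ0 hθ1 hc1 hc hcmax (fun _ => true)
    (fun _ => rfl) hε0 hε, ?_⟩
  have hpθ1 : p * θ < 1 := by nlinarith
  have hμ : ∀ (k : Fin (K + 1)) (x : Bool), 0 < (fun (k : Fin (K + 1)) (b : Bool) =>
      if k = 0 then (if b then p * θ else 1 - p * θ) else (if b then θ else 1 - θ)) k x := by
    intro k x
    by_cases hk : k = 0
    · simp only [hk, if_true]; split_ifs; exacts [mul_pos hp0 hθ0, by linarith]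
    · simp only [hk, if_false]; split_ifs; exacts [hθ0, by linarith]
  have hμ1 : ∀ k : Fin (K + 1), ∑ u, (fun (k : Fin (K + 1)) (b : Bool) =>
      if k = 0 then (if b then p * θ else 1 - p * θ) else (if b then θ else 1 - θ)) k u = 1 := by
    intro k
    by_cases hk : k = 0
    · simp only [hk, if_true]; exact sum_bool_law _
    · simp only [hk, if_false]; exact sum_bool_law _
  have hM := fun k : Fin (K + 1) => boolWitness_rowStochastic (K := K) hp0.le hp1 hθ0.le hθ1.le k
  have hMrev := fun k : Fin (K + 1) => boolWitness_detailedBalance (K := K) (p := p) (θ := θ) k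
  have hM0 : ∀ u v : Bool, (fun (k : Fin (K + 1)) (u v : Bool) =>
      if k = 0 then (if v then p * θ else 1 - p * θ) else (if u = v then (1 : ℝ) else 0)) 0 u v
      = (fun (k : Fin (K + 1)) (b : Bool) => if k = 0 then (if b then p * θ else 1 - p * θ) else (if b then θ else 1 - θ)) 0 v := by
    intro u v; simp only [if_true]
  have ha0 : 0 < p * (1 - θ) / (1 - p * θ) := div_pos (mul_pos hp0 (by linarith)) (by linarith)
  exact boolStar_mixingTime_le κ hm ht0 ht1 hw0 hw00 hw1 hμ hμ1 hM hMrev hM0 ha0 hc1 hc (boolWitness_accept_ge κ hp0 hp1 hθ0 hθ1) hε0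

end Witness

end Summit.Ventures.LatticeQCDFlow.Scaling

end
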